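import Literature.Dynamics.TransferOperators.MayerTransferOperator
import Mathlib.Analysis.Calculus.MeanValue
import Mathlib.Analysis.PSeries
import HarnessLib

/-!
# Mayer's transfer operator — estimates for the Hurwitz zeta function with complex parameter

Companion file to `Literature/Dynamics/TransferOperators/MayerTransferOperator.lean` (the
definitions). Here we prove the analytic estimates behind `hurwitzZetaC`:

* `norm_cpow_le_of_re_nonneg` — `‖z ^ w‖ ≤ ‖z‖ ^ Re w · exp(π/2 · |Im w|)` for `Re z ≥ 0`
  (principal branch: `|arg z| ≤ π/2`).
* `norm_hurwitzBracket_le`, `norm_hurwitzZetaCTerm_le` — the bracket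
  `c^{-s} - ((c+1)^{1-s} - c^{1-s})/(1-s)` (`= c^{-s} - ∫₀¹ (c+u)^{-s} du`) is bounded by
  `‖s‖ e^{π |Im s|/2} (Re c)^{-(Re s + 1)}` for `Re c > 0`, `Re s ≥ -1`, `s ≠ 1`. Proof by two
  applications of the mean value inequality on `[0, 1]` to `u ↦ (c+u)^{1-s}/(1-s)` and its
  derivative `u ↦ (c+u)^{-s}` (no integrals).
* `summable_hurwitzZetaCTerm` — absolute convergence of the defining series of `hurwitzZetaC s a`
  for `Re s > 0`, `s ≠ 1`, `Re a > 0`; hence the unconditional difference equation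
  `hurwitzZetaC_sub_add_one : ζ(s, a) - ζ(s, a+1) = a^{-s}` in that range.
* `differentiableOn_hurwitzZetaC` — `a ↦ ζ(s, a)` is holomorphic on the right half-plane
  `{Re a > 0}` (`Re s > 0`, `s ≠ 1`), by the Weierstrass M-test
  (`Complex.differentiableOn_tsum_of_summable_norm`) on the half-planes `{Re a > δ}`;
  `continuousOn_hurwitzZetaC` as a corollary; `norm_hurwitzZetaC_sub_le` — the tail bound
  `‖ζ(s,a) - a^{1-s}/(s-1)‖ ≤ ‖s‖ e^{π|Im s|/2} ∑ₙ (n + δ)^{-(Re s+1)}` uniformly on `{Re a ≥ δ}`.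

All statements are standard ([folklore]; cf. Whittaker–Watson §13.2, or [Mayer1990, (63)] for the
role of `ζ(2β, z+1)` in the continuation of the transfer operator).
-/

noncomputable section

open Complex Metric Set Filter Topology Real

namespace Literature.Dynamics.TransferOperators

/-! ### Powers in the right half-plane -/

/-- For `Re z ≥ 0` (so `|arg z| ≤ π/2`) and any `w`:
`‖z ^ w‖ ≤ ‖z‖ ^ Re w · exp (π/2 · |Im w|)` (principal branch). [folklore] -/
theorem norm_cpow_le_of_re_nonneg {z : ℂ} (hz : 0 ≤ z.re) (w : ℂ) :
    ‖z ^ w‖ ≤ ‖z‖ ^ w.re * Real.exp (π / 2 * |w.im|) := by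
  have h1 := Complex.norm_cpow_le z w
  have harg : |arg z| ≤ π / 2 := Complex.abs_arg_le_pi_div_two_iff.mpr hz
  have h2 : -(arg z * w.im) ≤ π / 2 * |w.im| := by
    have h3 : |arg z * w.im| ≤ π / 2 * |w.im| := by
      rw [abs_mul]
      exact mul_le_mul_of_nonneg_right harg (abs_nonneg _)
    have h4 := neg_abs_le (arg z * w.im)
    linarith
  calc ‖z ^ w‖ ≤ ‖z‖ ^ w.re / Real.exp (arg z * w.im) := h1
    _ = ‖z‖ ^ w.re * Real.exp (-(arg z * w.im)) := by
        rw [Real.exp_neg, div_eq_mul_inv]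
    _ ≤ ‖z‖ ^ w.re * Real.exp (π / 2 * |w.im|) :=
        mul_le_mul_of_nonneg_left (Real.exp_le_exp.mpr h2) (by positivity)

/-- For `Re z > 0` and `Re w ≤ 0`: `‖z ^ w‖ ≤ (Re z) ^ Re w · exp (π/2 · |Im w|)`. [folklore] -/
theorem norm_cpow_le_re_rpow_of_re_pos {z : ℂ} (hz : 0 < z.re) {w : ℂ} (hw : w.re ≤ 0) :
    ‖z ^ w‖ ≤ z.re ^ w.re * Real.exp (π / 2 * |w.im|) := by
  refine (norm_cpow_le_of_re_nonneg hz.le w).trans ?_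
  have h : ‖z‖ ^ w.re ≤ z.re ^ w.re :=
    Real.rpow_le_rpow_of_nonpos hz (re_le_norm z) hw
  exact mul_le_mul_of_nonneg_right h (Real.exp_pos _).le

/-! ### The bracket estimate -/

/-- **The bracket estimate.** For `s ≠ 1` with `Re s ≥ -1` and `Re c > 0`,
`‖c^{-s} - ((c+1)^{1-s} - c^{1-s})/(1-s)‖ ≤ ‖s‖ · e^{π|Im s|/2} · (Re c)^{-(Re s+1)}`.
The bracket is `-(G(1) - G(0) - G'(0))` for `G(u) = (c+u)^{1-s}/(1-s)`, whose second derivative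
`-s (c+u)^{-s-1}` has norm at most the right-hand side on `[0,1]`; two applications of the mean
value inequality. [folklore] -/
theorem norm_hurwitzBracket_le {s c : ℂ} (hs : s ≠ 1) (hσ : -1 ≤ s.re) (hc : 0 < c.re) :
    ‖c ^ (-s) - ((c + 1) ^ (1 - s) - c ^ (1 - s)) / (1 - s)‖ ≤
      ‖s‖ * Real.exp (π / 2 * |s.im|) * c.re ^ (-(s.re + 1)) := by
  have h1s : (1 - s) ≠ 0 := sub_ne_zero.mpr hs.symm
  set M : ℝ := ‖s‖ * Real.exp (π / 2 * |s.im|) * c.re ^ (-(s.re + 1)) with hM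
  -- the functions of the real variable `u`
  set G : ℝ → ℂ := fun u => (c + u) ^ (1 - s) / (1 - s) with hG
  set h : ℝ → ℂ := fun u => (c + u) ^ (-s) with hh
  set h' : ℝ → ℂ := fun u => -s * (c + u) ^ (-s - 1) with hh'
  have hre : ∀ u : ℝ, 0 ≤ u → 0 < (c + u).re := fun u hu => by
    simp only [add_re, ofReal_re]; linarith
  have hslit : ∀ u : ℝ, 0 ≤ u → (c + (u : ℂ)) ∈ slitPlane := fun u hu =>
    mem_slitPlane_iff.mpr (Or.inl (hre u hu))
  have hpow : ∀ (p : ℂ) (u : ℝ), 0 ≤ u →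
      HasDerivAt (fun y : ℝ => (c + (y : ℂ)) ^ p) (p * (c + u) ^ (p - 1)) u := fun p u hu => by
    have h1 := ((hasDerivAt_id ((u : ℝ) : ℂ)).const_add c).cpow_const (c := p) (hslit u hu)
    simpa using h1.comp_ofReal
  -- derivatives
  have hGd : ∀ u : ℝ, 0 ≤ u → HasDerivAt G (h u) u := fun u hu => by
    refine ((hpow (1 - s) u hu).div_const (1 - s)).congr_deriv ?_
    rw [sub_sub_cancel_left, mul_comm, mul_div_assoc, div_self h1s, mul_one, hh]
  have hhd : ∀ u : ℝ, 0 ≤ u → HasDerivAt h (h' u) u := fun u hu => by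
    refine (hpow (-s) u hu).congr_deriv ?_
    simp only [hh']
  -- bound on `h'`
  have hh'b : ∀ u : ℝ, 0 ≤ u → ‖h' u‖ ≤ M := fun u hu => by
    rw [hh', norm_mul, norm_neg, hM, mul_assoc]
    refine mul_le_mul_of_nonneg_left ?_ (norm_nonneg s)
    have hw : (-s - 1).re ≤ 0 := by simp only [sub_re, neg_re, one_re]; linarith
    refine (norm_cpow_le_re_rpow_of_re_pos (hre u hu) hw).trans ?_
    have him : |(-s - 1).im| = |s.im| := by simp [abs_neg]
    rw [him, mul_comm]
    refine mul_le_mul_of_nonneg_left ?_ (Real.exp_pos _).le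
    have hexp : (-s - 1).re = -(s.re + 1) := by simp only [sub_re, neg_re, one_re]; ring
    rw [hexp]
    refine Real.rpow_le_rpow_of_nonpos hc ?_ (by linarith)
    simp only [add_re, ofReal_re]; linarith
  have hM0 : 0 ≤ M := (norm_nonneg _).trans (hh'b 0 le_rfl)
  -- first mean value inequality: `‖h u - h 0‖ ≤ M * u ≤ M` on `[0, 1]`
  have hstep1 : ∀ u ∈ Icc (0 : ℝ) 1, ‖h u - h 0‖ ≤ M := by
    intro u hu
    have key := norm_image_sub_le_of_norm_deriv_le_segment' (f := h) (f' := h') (a := 0) (b := 1)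
      (fun x hx => (hhd x hx.1).hasDerivWithinAt) (fun x hx => hh'b x hx.1) u hu
    rw [sub_zero] at key
    exact key.trans (mul_le_of_le_one_right hM0 hu.2)
  -- second mean value inequality for `φ u = G u - u • h 0`
  have hstep2 : ‖(G 1 - (1 : ℝ) • h 0) - (G 0 - (0 : ℝ) • h 0)‖ ≤ M := by
    refine norm_image_sub_le_of_norm_deriv_le_segment_01' (f := fun u : ℝ => G u - u • h 0)
      (f' := fun u => h u - h 0) (fun x hx => ?_) (fun x hx => hstep1 x (Ico_subset_Icc_self hx))
    have hd : HasDerivAt (fun u : ℝ => G u - u • h 0) (h x - (1 : ℝ) • h 0) x :=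
      (hGd x hx.1).sub ((hasDerivAt_id x).smul_const (h 0))
    rw [one_smul] at hd
    exact hd.hasDerivWithinAt
  -- identify the bracket with `-(φ 1 - φ 0)`
  have hG1 : G 1 = (c + 1) ^ (1 - s) / (1 - s) := by simp [hG]
  have hG0 : G 0 = c ^ (1 - s) / (1 - s) := by simp [hG]
  have hh0 : h 0 = c ^ (-s) := by simp [hh]
  rw [one_smul, zero_smul, sub_zero, hG1, hG0, hh0] at hstep2
  calc ‖c ^ (-s) - ((c + 1) ^ (1 - s) - c ^ (1 - s)) / (1 - s)‖
      = ‖(c + 1) ^ (1 - s) / (1 - s) - c ^ (-s) - c ^ (1 - s) / (1 - s)‖ := by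
        rw [← norm_neg]; congr 1; ring
    _ ≤ M := hstep2

/-- **Term estimate** for the series of `hurwitzZetaC`: for `s ≠ 1`, `Re s ≥ -1`, `Re a > 0`,
`‖hurwitzZetaCTerm s a n‖ ≤ ‖s‖ e^{π|Im s|/2} (n + Re a)^{-(Re s+1)}`. [folklore] -/
theorem norm_hurwitzZetaCTerm_le {s a : ℂ} (hs : s ≠ 1) (hσ : -1 ≤ s.re) (ha : 0 < a.re) (n : ℕ) :
    ‖hurwitzZetaCTerm s a n‖ ≤
      ‖s‖ * Real.exp (π / 2 * |s.im|) * ((n : ℝ) + a.re) ^ (-(s.re + 1)) := by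
  have hc : 0 < ((n : ℂ) + a).re := by
    simp only [add_re, natCast_re]; positivity
  have h := norm_hurwitzBracket_le (c := (n : ℂ) + a) hs hσ hc
  simp only [add_re, natCast_re] at h
  exact h

/-- The comparison series `∑ₙ (n + x)^{-(σ+1)}` converges for `x > 0`, `σ > 0`. [folklore] -/
theorem summable_nat_add_rpow_neg {x σ : ℝ} (hx : 0 < x) (hσ : 0 < σ) :
    Summable fun n : ℕ => ((n : ℝ) + x) ^ (-(σ + 1)) := by
  have h := (Real.summable_one_div_nat_add_rpow x (σ + 1)).mpr (by linarith)
  refine h.congr fun n => ?_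
  have hn : 0 < (n : ℝ) + x := by positivity
  rw [abs_of_pos hn, Real.rpow_neg hn.le, one_div]

/-- **Absolute convergence** of the defining series of `hurwitzZetaC s a` for `Re s > 0`, `s ≠ 1`,
`Re a > 0`. [folklore] -/
theorem summable_hurwitzZetaCTerm {s a : ℂ} (hs : s ≠ 1) (hσ : 0 < s.re) (ha : 0 < a.re) :
    Summable (hurwitzZetaCTerm s a) := by
  refine Summable.of_norm_bounded ((summable_nat_add_rpow_neg ha hσ).mul_left
    (‖s‖ * Real.exp (π / 2 * |s.im|))) fun n => ?_
  exact norm_hurwitzZetaCTerm_le hs (by linarith) ha n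

/-- **Difference equation** `ζ(s, a) - ζ(s, a+1) = a^{-s}`, unconditionally for `Re s > 0`,
`s ≠ 1`, `Re a > 0`. [folklore] -/
theorem hurwitzZetaC_sub_add_one {s a : ℂ} (hs : s ≠ 1) (hσ : 0 < s.re) (ha : 0 < a.re) :
    hurwitzZetaC s a - hurwitzZetaC s (a + 1) = a ^ (-s) :=
  hurwitzZetaC_sub_hurwitzZetaC_add_one hs (summable_hurwitzZetaCTerm hs hσ ha)

/-! ### Uniform bounds and holomorphy in the parameter -/

/-- Uniform term bound on the half-plane `{Re a ≥ δ}`, `δ > 0`. [folklore] -/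
theorem norm_hurwitzZetaCTerm_le_of_le_re {s a : ℂ} {δ : ℝ} (hs : s ≠ 1) (hσ : -1 ≤ s.re)
    (hδ : 0 < δ) (ha : δ ≤ a.re) (n : ℕ) :
    ‖hurwitzZetaCTerm s a n‖ ≤
      ‖s‖ * Real.exp (π / 2 * |s.im|) * ((n : ℝ) + δ) ^ (-(s.re + 1)) := by
  refine (norm_hurwitzZetaCTerm_le hs hσ (hδ.trans_le ha) n).trans ?_
  refine mul_le_mul_of_nonneg_left ?_ (by positivity)
  exact Real.rpow_le_rpow_of_nonpos (by positivity) (by linarith) (by linarith)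

/-- Each term is holomorphic in the parameter `a` on the right half-plane. [folklore] -/
theorem differentiableOn_hurwitzZetaCTerm (s : ℂ) (n : ℕ) :
    DifferentiableOn ℂ (fun a => hurwitzZetaCTerm s a n) {a : ℂ | 0 < a.re} := by
  have hslit : ∀ a ∈ {a : ℂ | 0 < a.re}, (n : ℂ) + a ∈ slitPlane := fun a ha => by
    refine mem_slitPlane_iff.mpr (Or.inl ?_)
    have ha' : (0 : ℝ) < a.re := ha
    simp only [add_re, natCast_re]
    positivity
  have hslit1 : ∀ a ∈ {a : ℂ | 0 < a.re}, (n : ℂ) + a + 1 ∈ slitPlane := fun a ha => by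
    refine mem_slitPlane_iff.mpr (Or.inl ?_)
    have ha' : (0 : ℝ) < a.re := ha
    simp only [add_re, natCast_re, one_re]
    positivity
  have hb : DifferentiableOn ℂ (fun a : ℂ => (n : ℂ) + a) {a : ℂ | 0 < a.re} :=
    (differentiableOn_const _).add differentiableOn_id
  have hb1 : DifferentiableOn ℂ (fun a : ℂ => (n : ℂ) + a + 1) {a : ℂ | 0 < a.re} :=
    hb.add_const 1
  unfold hurwitzZetaCTerm
  exact (hb.cpow_const hslit).sub (((hb1.cpow_const hslit1).sub (hb.cpow_const hslit)).div_const _)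

/-- The series part `a ↦ ∑ₙ hurwitzZetaCTerm s a n` is holomorphic on `{Re a > δ}` for every
`δ > 0` (Weierstrass M-test), for `Re s > 0`, `s ≠ 1`. [folklore] -/
theorem differentiableOn_tsum_hurwitzZetaCTerm {s : ℂ} {δ : ℝ} (hs : s ≠ 1) (hσ : 0 < s.re)
    (hδ : 0 < δ) :
    DifferentiableOn ℂ (fun a => ∑' n, hurwitzZetaCTerm s a n) {a : ℂ | δ < a.re} := by
  have hopen : IsOpen {a : ℂ | δ < a.re} := isOpen_lt continuous_const Complex.continuous_re
  refine Complex.differentiableOn_tsum_of_summable_norm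
    ((summable_nat_add_rpow_neg hδ hσ).mul_left (‖s‖ * Real.exp (π / 2 * |s.im|)))
    (fun n => (differentiableOn_hurwitzZetaCTerm s n).mono fun a ha => hδ.trans ha) hopen ?_
  intro n a ha
  exact norm_hurwitzZetaCTerm_le_of_le_re hs (by linarith) hδ (le_of_lt ha) n

/-- **Holomorphy of `a ↦ ζ(s, a)` on the right half-plane** `{Re a > 0}`, for `Re s > 0`,
`s ≠ 1`. [folklore] -/
theorem differentiableOn_hurwitzZetaC {s : ℂ} (hs : s ≠ 1) (hσ : 0 < s.re) :
    DifferentiableOn ℂ (hurwitzZetaC s) {a : ℂ | 0 < a.re} := by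
  intro a ha
  have ha' : (0 : ℝ) < a.re := ha
  have hδ : 0 < a.re / 2 := by positivity
  have hmem : a ∈ {b : ℂ | a.re / 2 < b.re} := by
    show a.re / 2 < a.re
    linarith
  have hopen : IsOpen {b : ℂ | a.re / 2 < b.re} := isOpen_lt continuous_const Complex.continuous_re
  have h1 : DifferentiableAt ℂ (fun b => ∑' n, hurwitzZetaCTerm s b n) a :=
    (differentiableOn_tsum_hurwitzZetaCTerm hs hσ hδ).differentiableAt (hopen.mem_nhds hmem)
  have hslit : a ∈ slitPlane := mem_slitPlane_iff.mpr (Or.inl ha')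
  have h2 : DifferentiableAt ℂ (fun b : ℂ => b ^ (1 - s) / (s - 1)) a :=
    (differentiableAt_id.cpow_const hslit).div_const _
  have h3 : DifferentiableAt ℂ (hurwitzZetaC s) a := by
    have : hurwitzZetaC s = fun b => (∑' n, hurwitzZetaCTerm s b n) + b ^ (1 - s) / (s - 1) := by
      ext b; rfl
    rw [this]
    exact h1.add h2
  exact h3.differentiableWithinAt

/-- Continuity of `a ↦ ζ(s, a)` on the right half-plane (`Re s > 0`, `s ≠ 1`). [folklore] -/
theorem continuousOn_hurwitzZetaC {s : ℂ} (hs : s ≠ 1) (hσ : 0 < s.re) :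
    ContinuousOn (hurwitzZetaC s) {a : ℂ | 0 < a.re} :=
  (differentiableOn_hurwitzZetaC hs hσ).continuousOn

/-- **Uniform tail bound**: on `{Re a ≥ δ}` (`δ > 0`), for `Re s > 0`, `s ≠ 1`,
`‖ζ(s, a) - a^{1-s}/(s-1)‖ ≤ ‖s‖ e^{π|Im s|/2} ∑ₙ (n+δ)^{-(Re s+1)}`. [folklore] -/
theorem norm_hurwitzZetaC_sub_le {s a : ℂ} {δ : ℝ} (hs : s ≠ 1) (hσ : 0 < s.re) (hδ : 0 < δ)
    (ha : δ ≤ a.re) :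
    ‖hurwitzZetaC s a - a ^ (1 - s) / (s - 1)‖ ≤
      ‖s‖ * Real.exp (π / 2 * |s.im|) * ∑' n : ℕ, ((n : ℝ) + δ) ^ (-(s.re + 1)) := by
  rw [hurwitzZetaC_def, add_sub_cancel_right, ← tsum_mul_left]
  refine tsum_of_norm_bounded ?_ fun n => norm_hurwitzZetaCTerm_le_of_le_re hs (by linarith) hδ ha n
  exact ((summable_nat_add_rpow_neg hδ hσ).mul_left _).hasSum

end Literature.Dynamics.TransferOperators
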